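import Literature.AlgebraicGeometry.Resolution.KawasakiCharts
import Literature.AlgebraicGeometry.Resolution.LocalizedSurjection
import HarnessLib

/-!
# The overlap of two charts of a closed subscheme of `ℙⁿ_k`: sections, chart modules and
Kawasaki's annihilator ideals under the change of chart

Topic: `Literature/AlgebraicGeometry/Resolution` (plumbing of the global step of Kawasaki's
Macaulayfication, Kawasaki 2000, La. 5.3: the annihilator ideals `𝔞(·)` of the affine pieces of a
closed subscheme `X ⊆ ℙⁿ` agree on the overlaps of the standard charts).

For `ι : Z → ℙⁿ_k` affine (a closed immersion where stated), homogeneous `f`, `g` of positive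
degrees `d`, `e` and `x = f g`, write `B_f = (k[x]_{(f)})₀`, `C = (k[x]_{(x)})₀ = B_f[1/t]`
(`t = g^d/f^e`, Mathlib `HomogeneousLocalization.Away.isLocalization_mul`), `A_f = Γ(Z, Z_f)`,
`A_x = Γ(Z, Z_x)` (`Z_H = ι⁻¹ D₊(H)`, `ProjFrac.ZH`) and `ρ : A_f → A_x` for the restriction.

* `isLocalization_away_sections_ZH` — **`A_x = A_f[1/s]`** for the section `s = evalAway f t`
  (`Z_x` is the basic open of `s` in the affine `Z_f`, `ProjFrac.ZH_mul_eq_basicOpen_evalAway`,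
  and Mathlib `IsAffineOpen.isLocalization_of_eq_basicOpen`);
* `exists_isLocalizedModule_chartQuot` / `exists_isBaseChange_chartQuot` — for ideals
  `I ≤ A_f`, `I' = I A_x ≤ A_x` the map of chart modules `A_f ⧸ I → A_x ⧸ I'` induced by `ρ` is
  `B_f`-linear (for the `B_f`-module structure of `A_x ⧸ I'` through `awayMap : B_f → C`) and
  exhibits `A_x ⧸ I'` as the localization at `t`, i.e. as the BASE CHANGE `C ⊗_{B_f} (A_f ⧸ I)`
  (quotients commute with localization, `LocalizedSurjection.isLocalizedModule_quotientMapₗ`,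
  then Mathlib `IsLocalizedModule.restrictScalars_powers`, `isLocalizedModule_iff_isBaseChange`);
* `IdealSheafData.ideal_eq_map_of_eq_basicOpen`, `idealSheafData_ideal_ZH_eq_map` — the chart
  ideals of ONE ideal sheaf satisfy `I' = I A_x`;
* `chartAnn_map_awayMap_eq` — **two-chart compatibility of Kawasaki's annihilator ideals**: if the
  chart ideals `I_j ≤ A_{x_j}`, `I_l ≤ A_{x_l}` extend to the same ideal of `A_{x_j x_l}`, then
  `chartAnn_j(I_j) · C = chartAnn_l(I_l) · C` in the overlap ring `C = (k[x]_{(x_j x_l)})₀`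
  (positive window), by `ExtAnnihilatorCharts.extAnn_map_eq_of_isLocalization₂`; the family form
  `chartAnn_map_awayMap_eq_of_forall` and the ideal-sheaf form
  `chartAnn_map_awayMap_eq_of_idealSheafData`;
* `span_evalAway_mk_map_eq`, `chartAnn_map_awayMap_eq_of_forms` — the case of chart ideals
  generated by the dehomogenisations `G_i / x_j^{m_i}` of a family of forms (Kawasaki's `r_1, …,
  r_{i-1}`): on the overlap the generators differ by the units `(x_j/x_l)^{m_i}`
  (`awayMap_mk_eq_pow_mul_awayMap_mk`, `isUnit_awayMap_isLocalizationElem`).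

Everything is proved; no named facts; no new definitions (the extra algebra structures are
introduced with `letI` in the statements, as in `KawasakiCharts.isLocalization_away_mul`). As in
`KawasakiCharts.lean`, Mathlib's `MvPolynomial.gradedAlgebra` (a `def`) is a local instance so that
`HomogeneousLocalization.Away (grading k n) _` makes sense; nothing else is made an instance.

## References

* T. Kawasaki, *On Macaulayfication of Noetherian schemes*, Trans. AMS 352 (2000), La. 5.3 and
  the proof of Thm. 5.1 (p. 2538–2539). [Kawasaki2000]
* R. Hartshorne, *Algebraic Geometry* (1977), II Prop. 2.2 (b), II Prop. 2.5 (b), II Prop. 5.1 (c).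
  [Hartshorne1977]
-/

noncomputable section

open CategoryTheory AlgebraicGeometry TopologicalSpace HomogeneousLocalization MvPolynomial
open Literature.AlgebraicGeometry.Morphisms Literature.AlgebraicGeometry.Morphisms.ProjCech
open Literature.AlgebraicGeometry.Motives Literature.AlgebraicGeometry.Motives.ProjFrac

universe u

attribute [local instance] MvPolynomial.gradedAlgebra

namespace Literature.AlgebraicGeometry.Resolution

/-! ## Chart ideals of one ideal sheaf on a basic open -/

/-- For an ideal sheaf `𝒥` and affine opens `V ⊆ U` with `V = X_s` the basic open of a section
`s ∈ Γ(X, U)`: `𝒥(V) = 𝒥(U) · Γ(X, V)` (quasi-coherence: Mathlib's axiom `map_ideal_basicOpen` of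
`IdealSheafData`, transported along the equality of opens). [cite: Hartshorne1977, II Prop. 5.1 (c)] -/
theorem IdealSheafData.ideal_eq_map_of_eq_basicOpen {X : Scheme.{u}} (𝒥 : X.IdealSheafData)
    (U V : X.affineOpens) (s : Γ(X, U)) (hV : (V : X.Opens) = X.basicOpen s) :
    𝒥.ideal V = (𝒥.ideal U).map
      (X.presheaf.map (homOfLE (hV.trans_le (X.basicOpen_le s) : (V : X.Opens) ≤ U)).op).hom := by
  obtain ⟨V, hVaff⟩ := V
  change V = X.basicOpen s at hV
  subst hV
  exact (𝒥.map_ideal_basicOpen U s).symm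

variable {k : Type u} [Field k] {n : ℕ} {Z : Scheme.{u}} (ι : Z ⟶ PP k n)

section Overlap

variable {d e : ℕ} {f g x : MvPolynomial (Fin (n + 1)) k}
  (hf : f ∈ grading k n d) (hg : g ∈ grading k n e) (hx : x = f * g) (hd : 0 < d) (he : 0 < e)

/-! ## The sections over `Z_{fg}` as a localization of the sections over `Z_f` -/

include hx hd he in
/-- **`Z_x` is the basic open in `Z` of the section `evalAway f (g^d/f^e)`** for `x = f g`
(`D₊(fg) ⊆ D₊(f) ≅ Spec (k[x]_{(f)})₀` is the basic open `D(g^d/f^e)`, pulled back along `ι`).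
[cite: Hartshorne1977, II Prop. 2.5 (b)] -/
theorem ZH_eq_basicOpen_evalAway :
    ZH ι x = Z.basicOpen (evalAway ι f (Away.isLocalizationElem hf hg)) := by
  subst hx
  exact ZH_mul_eq_basicOpen_evalAway ι hf hd hg he

include hd he in
/-- **`Γ(Z, Z_{fg}) = Γ(Z, Z_f)[1/s]`** for the section `s = evalAway f (g^d/f^e)`, the algebra
structure being restriction of sections (`Z_f` is affine for `ι` affine). [cite: Hartshorne1977,
II Prop. 2.2 (b) and II Prop. 2.5 (b); Kawasaki2000, proof of La. 5.3] -/
theorem isLocalization_away_sections_ZH [IsAffineHom ι] :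
    letI := (Z.presheaf.map (homOfLE (ZH_mono ι ⟨g, hx⟩)).op).hom.toAlgebra
    IsLocalization.Away (evalAway ι f (Away.isLocalizationElem hf hg)) Γ(Z, ZH ι x) :=
  (isAffineOpen_ZH ι hf hd).isLocalization_of_eq_basicOpen _ (homOfLE (ZH_mono ι ⟨g, hx⟩))
    (ZH_eq_basicOpen_evalAway ι hf hg hx hd he)

include hd he in
/-- **The chart ideals of one ideal sheaf extend**: `𝒥(Z_x) = 𝒥(Z_f) · Γ(Z, Z_x)` for `x = f g`
(quasi-coherence of `𝒥` on the affine `Z_f`). [cite: Hartshorne1977, II Prop. 5.1 (c)] -/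
theorem idealSheafData_ideal_ZH_eq_map [IsAffineHom ι] (𝒥 : Z.IdealSheafData) :
    𝒥.ideal ⟨ZH ι x, isAffineOpen_ZH ι (hx ▸ SetLike.mul_mem_graded hf hg) (Nat.add_pos_left hd e)⟩ =
      (𝒥.ideal ⟨ZH ι f, isAffineOpen_ZH ι hf hd⟩).map
        (Z.presheaf.map (homOfLE (ZH_mono ι ⟨g, hx⟩)).op).hom :=
  IdealSheafData.ideal_eq_map_of_eq_basicOpen 𝒥 ⟨ZH ι f, isAffineOpen_ZH ι hf hd⟩ _
    (evalAway ι f (Away.isLocalizationElem hf hg)) (ZH_eq_basicOpen_evalAway ι hf hg hx hd he)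

/-! ## The chart modules over `Z_{fg}` as base changes of the chart modules over `Z_f` -/

include hd he in
/-- **`A_x ⧸ I A_x` is the localization of the chart module `A_f ⧸ I` at `t = g^d/f^e`**: for
`I ≤ A_f = Γ(Z, Z_f)` and `I' = I · A_x`, the map `A_f ⧸ I → A_x ⧸ I'` induced by restriction is
`B_f`-linear for the `B_f = (k[x]_{(f)})₀`-module structure of `A_x ⧸ I'` through
`awayMap : B_f → (k[x]_{(x)})₀`, and is a localization at the powers of `t`. [cite: Kawasaki2000,
proof of La. 5.3] -/
theorem exists_isLocalizedModule_chartQuot [IsAffineHom ι] (I : Ideal Γ(Z, ZH ι f)) (I' : Ideal Γ(Z, ZH ι x))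
    (hI : I.map (Z.presheaf.map (homOfLE (ZH_mono ι ⟨g, hx⟩)).op).hom = I') :
    letI : Algebra (Away (grading k n) f) (ChartQuot ι x I') :=
      ((algebraMap (Away (grading k n) x) (ChartQuot ι x I')).comp (awayMap (grading k n) hg hx)).toAlgebra
    ∃ φ : ChartQuot ι f I →ₗ[Away (grading k n) f] ChartQuot ι x I',
      (∀ a, φ (Ideal.Quotient.mk I a) =
        Ideal.Quotient.mk I' ((Z.presheaf.map (homOfLE (ZH_mono ι ⟨g, hx⟩)).op).hom a)) ∧
      IsLocalizedModule (Submonoid.powers (Away.isLocalizationElem hf hg)) φ := by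
  -- notation
  let B := Away (grading k n) f
  let C := Away (grading k n) x
  let A := Γ(Z, ZH ι f)
  let A' := Γ(Z, ZH ι x)
  let ψ : B →+* C := awayMap (grading k n) hg hx
  let ρ : A →+* A' := (Z.presheaf.map (homOfLE (ZH_mono ι ⟨g, hx⟩)).op).hom
  let t : B := Away.isLocalizationElem hf hg
  letI instBN : Algebra B (ChartQuot ι x I') := ((algebraMap C (ChartQuot ι x I')).comp ψ).toAlgebra
  -- the ring-level structures
  letI : Algebra B A := (evalAway ι f).toAlgebra
  letI : Algebra A A' := ρ.toAlgebra
  haveI : IsLocalization.Away (evalAway ι f t) A' := isLocalization_away_sections_ZH ι hf hg hx hd he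
  -- the `A`-module structure of `A' ⧸ I'`
  letI instAN : Algebra A (ChartQuot ι x I') := inferInstanceAs (Algebra A (A' ⧸ I'))
  haveI : IsScalarTower B A (ChartQuot ι f I) := IsScalarTower.of_algebraMap_eq fun _ => rfl
  haveI : IsScalarTower B A (ChartQuot ι x I') := IsScalarTower.of_algebraMap_eq fun b => by
    change Ideal.Quotient.mk I' (evalAway ι x (ψ b)) = Ideal.Quotient.mk I' (ρ (evalAway ι f b))
    rw [evalAway_awayMap]
  -- the `A`-linear quotient map and its localization property
  have hI' : I.map (algebraMap A A') = I' := hI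
  let e : (A' ⧸ I.map (algebraMap A A')) ≃ₐ[A] (A' ⧸ I') := Ideal.quotientEquivAlgOfEq A hI'
  let φA : ChartQuot ι f I →ₗ[A] ChartQuot ι x I' :=
    e.toLinearEquiv.toLinearMap ∘ₗ quotientMapₗ A' I
  haveI hφA : IsLocalizedModule (Submonoid.powers (evalAway ι f t)) φA := by
    haveI := isLocalizedModule_quotientMapₗ (Submonoid.powers (evalAway ι f t)) A' I
    exact IsLocalizedModule.of_linearEquiv (Submonoid.powers (evalAway ι f t)) (quotientMapₗ A' I)
      e.toLinearEquiv
  haveI : IsLocalizedModule (Submonoid.powers (algebraMap B A t)) φA := hφA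
  refine ⟨φA.restrictScalars B, fun a => ?_, IsLocalizedModule.restrictScalars_powers t φA⟩
  change e (quotientMapₗ A' I (Ideal.Quotient.mk I a)) = _
  rw [quotientMapₗ_mk]
  exact Ideal.quotientEquivAlgOfEq_mk A hI' _

include hd he in
/-- **`A_x ⧸ I A_x = (k[x]_{(x)})₀ ⊗_{(k[x]_{(f)})₀} (A_f ⧸ I)`**: the same map is a base change along
the change of chart rings `awayMap : (k[x]_{(f)})₀ → (k[x]_{(x)})₀` (a localization at `t`).
[cite: Kawasaki2000, proof of La. 5.3] -/
theorem exists_isBaseChange_chartQuot [IsAffineHom ι] (I : Ideal Γ(Z, ZH ι f)) (I' : Ideal Γ(Z, ZH ι x))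
    (hI : I.map (Z.presheaf.map (homOfLE (ZH_mono ι ⟨g, hx⟩)).op).hom = I') :
    letI : Algebra (Away (grading k n) f) (Away (grading k n) x) := (awayMap (grading k n) hg hx).toAlgebra
    letI : Algebra (Away (grading k n) f) (ChartQuot ι x I') :=
      ((algebraMap (Away (grading k n) x) (ChartQuot ι x I')).comp (awayMap (grading k n) hg hx)).toAlgebra
    haveI : IsScalarTower (Away (grading k n) f) (Away (grading k n) x) (ChartQuot ι x I') :=
      IsScalarTower.of_algebraMap_eq fun _ => rfl
    ∃ φ : ChartQuot ι f I →ₗ[Away (grading k n) f] ChartQuot ι x I',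
      (∀ a, φ (Ideal.Quotient.mk I a) =
        Ideal.Quotient.mk I' ((Z.presheaf.map (homOfLE (ZH_mono ι ⟨g, hx⟩)).op).hom a)) ∧
      IsLocalizedModule (Submonoid.powers (Away.isLocalizationElem hf hg)) φ ∧
      IsBaseChange (Away (grading k n) x) φ := by
  letI : Algebra (Away (grading k n) f) (Away (grading k n) x) := (awayMap (grading k n) hg hx).toAlgebra
  letI : Algebra (Away (grading k n) f) (ChartQuot ι x I') :=
    ((algebraMap (Away (grading k n) x) (ChartQuot ι x I')).comp (awayMap (grading k n) hg hx)).toAlgebra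
  haveI : IsScalarTower (Away (grading k n) f) (Away (grading k n) x) (ChartQuot ι x I') :=
    IsScalarTower.of_algebraMap_eq fun _ => rfl
  haveI : IsLocalization.Away (Away.isLocalizationElem hf hg) (Away (grading k n) x) :=
    Away.isLocalization_mul hf hg hx hd.ne'
  obtain ⟨φ, hφ, hloc⟩ := exists_isLocalizedModule_chartQuot ι hf hg hx hd he I I' hI
  exact ⟨φ, hφ, hloc, (isLocalizedModule_iff_isBaseChange
    (Submonoid.powers (Away.isLocalizationElem hf hg)) (Away (grading k n) x) φ).mp hloc⟩

end Overlap

/-! ## Two-chart compatibility of Kawasaki's annihilator ideals -/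

section TwoCharts

variable [IsClosedImmersion ι]

/-- **Kawasaki 2000, La. 5.3 (the overlap comparison).** If the chart ideals `I_j ≤ Γ(Z, Z_{x_j})`
and `I_l ≤ Γ(Z, Z_{x_l})` generate the same ideal `I'` of `Γ(Z, Z_{x_j x_l})`, then for a positive
window `T` the annihilator ideals of the two charts extend to the same ideal of the overlap ring
`(k[x]_{(x_j x_l)})₀`: `chartAnn_j(I_j) · C = chartAnn_l(I_l) · C` (both are the `Ext`-annihilator of
the overlap module `Γ(Z, Z_{x_j x_l}) ⧸ I'`, a common base change). [cite: Kawasaki2000, La. 5.3] -/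
theorem chartAnn_map_awayMap_eq (j l : Fin (n + 1)) (Ij : Ideal Γ(Z, ZH ι (X j)))
    (Il : Ideal Γ(Z, ZH ι (X l))) (I' : Ideal Γ(Z, ZH ι (X j * X l)))
    (hj : Ij.map (Z.presheaf.map (homOfLE (ZH_mono ι ⟨X l, rfl⟩)).op).hom = I')
    (hl : Il.map (Z.presheaf.map (homOfLE (ZH_mono ι ⟨X j, mul_comm (X j) (X l)⟩)).op).hom = I')
    (T : Finset ℕ) (hT : ∀ q ∈ T, 1 ≤ q) :
    (chartAnn ι j Ij T).map (awayMap (grading k n) (Segre.X_mem k l)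
        (rfl : (X j * X l : MvPolynomial (Fin (n + 1)) k) = X j * X l)) =
      (chartAnn ι l Il T).map (awayMap (grading k n) (Segre.X_mem k j)
        (mul_comm (X j) (X l) : (X j * X l : MvPolynomial (Fin (n + 1)) k) = X l * X j)) := by
  let C := Away (grading k n) (X j * X l : MvPolynomial (Fin (n + 1)) k)
  let ψj := awayMap (grading k n) (Segre.X_mem k l)
    (rfl : (X j * X l : MvPolynomial (Fin (n + 1)) k) = X j * X l)
  let ψl := awayMap (grading k n) (Segre.X_mem k j)
    (mul_comm (X j) (X l) : (X j * X l : MvPolynomial (Fin (n + 1)) k) = X l * X j)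
  -- the `j`-side structures
  letI : Algebra (Away (grading k n) (X j : MvPolynomial (Fin (n + 1)) k)) C := ψj.toAlgebra
  letI : Algebra (Away (grading k n) (X j : MvPolynomial (Fin (n + 1)) k)) (ChartQuot ι (X j * X l) I') :=
    ((algebraMap C (ChartQuot ι (X j * X l) I')).comp ψj).toAlgebra
  haveI : IsScalarTower (Away (grading k n) (X j : MvPolynomial (Fin (n + 1)) k)) C
      (ChartQuot ι (X j * X l) I') := IsScalarTower.of_algebraMap_eq fun _ => rfl
  haveI : IsLocalization.Away (Away.isLocalizationElem (Segre.X_mem k j) (Segre.X_mem k l)) C :=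
    Away.isLocalization_mul (Segre.X_mem k j) (Segre.X_mem k l) rfl one_ne_zero
  -- the `l`-side structures
  letI : Algebra (Away (grading k n) (X l : MvPolynomial (Fin (n + 1)) k)) C := ψl.toAlgebra
  letI : Algebra (Away (grading k n) (X l : MvPolynomial (Fin (n + 1)) k)) (ChartQuot ι (X j * X l) I') :=
    ((algebraMap C (ChartQuot ι (X j * X l) I')).comp ψl).toAlgebra
  haveI : IsScalarTower (Away (grading k n) (X l : MvPolynomial (Fin (n + 1)) k)) C
      (ChartQuot ι (X j * X l) I') := IsScalarTower.of_algebraMap_eq fun _ => rfl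
  haveI : IsLocalization.Away (Away.isLocalizationElem (Segre.X_mem k l) (Segre.X_mem k j)) C :=
    Away.isLocalization_mul (Segre.X_mem k l) (Segre.X_mem k j) (mul_comm (X j) (X l)) one_ne_zero
  obtain ⟨φj, -, -, hφj⟩ :=
    exists_isBaseChange_chartQuot ι (Segre.X_mem k j) (Segre.X_mem k l) rfl one_pos one_pos Ij I' hj
  obtain ⟨φl, -, -, hφl⟩ := exists_isBaseChange_chartQuot ι (Segre.X_mem k l) (Segre.X_mem k j)
    (mul_comm (X j) (X l)) one_pos one_pos Il I' hl
  exact extAnn_map_eq_of_isLocalization₂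
    (Submonoid.powers (Away.isLocalizationElem (Segre.X_mem k j) (Segre.X_mem k l)))
    (Submonoid.powers (Away.isLocalizationElem (Segre.X_mem k l) (Segre.X_mem k j)))
    φj hφj φl hφl T hT

/-- **Family form** (the hypothesis `hcompat` of the homogenisation step of La. 5.3): if for all
`j, l` the chart ideals `I j`, `I l` extend to a common ideal of `Γ(Z, Z_{x_j x_l})`, then the chart
annihilator ideals agree on every overlap. [cite: Kawasaki2000, La. 5.3] -/
theorem chartAnn_map_awayMap_eq_of_forall (I : ∀ j : Fin (n + 1), Ideal Γ(Z, ZH ι (X j)))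
    (hI : ∀ j l : Fin (n + 1),
      (I j).map (Z.presheaf.map (homOfLE (ZH_mono ι ⟨X l, rfl⟩)).op).hom =
        (I l).map (Z.presheaf.map (homOfLE (ZH_mono ι ⟨X j, mul_comm (X j) (X l)⟩)).op).hom)
    (T : Finset ℕ) (hT : ∀ q ∈ T, 1 ≤ q) (j l : Fin (n + 1)) :
    (chartAnn ι j (I j) T).map (awayMap (grading k n) (Segre.X_mem k l)
        (rfl : (X j * X l : MvPolynomial (Fin (n + 1)) k) = X j * X l)) =
      (chartAnn ι l (I l) T).map (awayMap (grading k n) (Segre.X_mem k j)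
        (mul_comm (X j) (X l) : (X j * X l : MvPolynomial (Fin (n + 1)) k) = X l * X j)) :=
  chartAnn_map_awayMap_eq ι j l (I j) (I l) _ rfl (hI j l).symm T hT

/-- **Ideal-sheaf form**: the chart ideals `𝒥(Z_{x_j})` of ONE ideal sheaf `𝒥` on `Z` have
compatible annihilator ideals on every overlap (positive window). [cite: Kawasaki2000, La. 5.3] -/
theorem chartAnn_map_awayMap_eq_of_idealSheafData (𝒥 : Z.IdealSheafData) (T : Finset ℕ)
    (hT : ∀ q ∈ T, 1 ≤ q) (j l : Fin (n + 1)) :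
    (chartAnn ι j (𝒥.ideal ⟨ZH ι (X j), isAffineOpen_ZH ι (Segre.X_mem k j) one_pos⟩) T).map
        (awayMap (grading k n) (Segre.X_mem k l)
          (rfl : (X j * X l : MvPolynomial (Fin (n + 1)) k) = X j * X l)) =
      (chartAnn ι l (𝒥.ideal ⟨ZH ι (X l), isAffineOpen_ZH ι (Segre.X_mem k l) one_pos⟩) T).map
        (awayMap (grading k n) (Segre.X_mem k j)
          (mul_comm (X j) (X l) : (X j * X l : MvPolynomial (Fin (n + 1)) k) = X l * X j)) :=
  chartAnn_map_awayMap_eq ι j l _ _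
    (𝒥.ideal ⟨ZH ι (X j * X l), isAffineOpen_ZH ι (X_mul_X_mem j l) two_pos⟩)
    (idealSheafData_ideal_ZH_eq_map ι (Segre.X_mem k j) (Segre.X_mem k l) rfl one_pos one_pos 𝒥).symm
    (idealSheafData_ideal_ZH_eq_map ι (Segre.X_mem k l) (Segre.X_mem k j) (mul_comm (X j) (X l))
      one_pos one_pos 𝒥).symm
    T hT


/-! ## Chart ideals generated by dehomogenised forms -/

omit [IsClosedImmersion ι] in
/-- **The two dehomogenisations of a form on an overlap** `D₊(x_j x_l)`: for a form `G` of degree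
`m`, `G/x_l^m = (x_j/x_l)^m · G/x_j^m` in `(k[x]_{(x_j x_l)})₀` (read through the two `awayMap`s;
`x_j/x_l = Away.isLocalizationElem`; the computation of the W1 draft `awayMap_dehomog_eq` of
res-D-pv-019, cell res-hironaka). [cite: Hartshorne1977, II Prop. 2.5 (b) (proof)] -/
theorem awayMap_mk_eq_pow_mul_awayMap_mk (j l : Fin (n + 1)) (m : ℕ)
    (G : MvPolynomial (Fin (n + 1)) k) (hG : G ∈ grading k n (m • 1)) :
    awayMap (grading k n) (Segre.X_mem k j)
        (mul_comm (X j) (X l) : (X j * X l : MvPolynomial (Fin (n + 1)) k) = X l * X j)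
        (Away.mk (grading k n) (Segre.X_mem k l) m G hG) =
      awayMap (grading k n) (Segre.X_mem k j)
          (mul_comm (X j) (X l) : (X j * X l : MvPolynomial (Fin (n + 1)) k) = X l * X j)
          (Away.isLocalizationElem (Segre.X_mem k l) (Segre.X_mem k j)) ^ m *
        awayMap (grading k n) (Segre.X_mem k l)
          (rfl : (X j * X l : MvPolynomial (Fin (n + 1)) k) = X j * X l)
          (Away.mk (grading k n) (Segre.X_mem k j) m G hG) := by
  rw [HomogeneousLocalization.ext_iff_val, HomogeneousLocalization.val_mul,
    HomogeneousLocalization.val_pow]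
  simp only [Away.isLocalizationElem, HomogeneousLocalization.awayMap_mk,
    HomogeneousLocalization.Away.val_mk, Localization.mk_pow, Localization.mk_mul]
  rw [Localization.mk_eq_mk_iff, Localization.r_iff_exists]
  refine ⟨1, ?_⟩
  simp only [OneMemClass.coe_one, one_mul, Submonoid.coe_mul, SubmonoidClass.coe_pow]
  ring

omit [IsClosedImmersion ι] in
/-- The gluing element `x_j/x_l` becomes a unit in the overlap ring `(k[x]_{(x_j x_l)})₀`
(`(k[x]_{(x_j x_l)})₀ = (k[x]_{(x_l)})₀[x_l/x_j]`). [cite: Hartshorne1977, II Prop. 2.5 (b) (proof)] -/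
theorem isUnit_awayMap_isLocalizationElem (j l : Fin (n + 1)) :
    IsUnit (awayMap (grading k n) (Segre.X_mem k j)
      (mul_comm (X j) (X l) : (X j * X l : MvPolynomial (Fin (n + 1)) k) = X l * X j)
      (Away.isLocalizationElem (Segre.X_mem k l) (Segre.X_mem k j))) := by
  letI := (awayMap (grading k n) (Segre.X_mem k j)
    (mul_comm (X j) (X l) : (X j * X l : MvPolynomial (Fin (n + 1)) k) = X l * X j)).toAlgebra
  haveI : IsLocalization.Away (Away.isLocalizationElem (Segre.X_mem k l) (Segre.X_mem k j))
      (Away (grading k n) (X j * X l : MvPolynomial (Fin (n + 1)) k)) :=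
    Away.isLocalization_mul (Segre.X_mem k l) (Segre.X_mem k j) (mul_comm (X j) (X l)) one_ne_zero
  exact IsLocalization.Away.algebraMap_isUnit (Away.isLocalizationElem (Segre.X_mem k l) (Segre.X_mem k j))

omit [IsClosedImmersion ι] in
/-- Spans of families of associated elements coincide: if `b i = u i * a i` with units `u i`, then
`span (range a) = span (range b)`. [folklore] -/
private theorem span_range_eq_of_unit_mul {R : Type*} [CommRing R] {σ : Type*} (a b : σ → R) (u : σ → R)
    (hu : ∀ i, IsUnit (u i)) (h : ∀ i, b i = u i * a i) :
    Ideal.span (Set.range a) = Ideal.span (Set.range b) := by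
  refine le_antisymm (Ideal.span_le.mpr ?_) (Ideal.span_le.mpr ?_)
  · rintro _ ⟨i, rfl⟩
    obtain ⟨v, hv⟩ := hu i
    have : a i = ↑v⁻¹ * b i := by rw [h i, ← hv, ← mul_assoc, Units.inv_mul, one_mul]
    rw [SetLike.mem_coe, this]
    exact Ideal.mul_mem_left _ _ (Ideal.subset_span ⟨i, rfl⟩)
  · rintro _ ⟨i, rfl⟩
    rw [SetLike.mem_coe, h i]
    exact Ideal.mul_mem_left _ _ (Ideal.subset_span ⟨i, rfl⟩)

omit [IsClosedImmersion ι] in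
/-- **Chart ideals generated by dehomogenised forms extend to a common ideal on the overlap.** For
forms `G i` of degrees `m i`, the ideals `I_j = (G i / x_j^{m i})_i · Γ(Z, Z_{x_j})` of the chart
rings of `Z` satisfy `I_j · Γ(Z, Z_{x_j x_l}) = I_l · Γ(Z, Z_{x_j x_l})` (the generators differ by the
units `(x_j/x_l)^{m i}`). The degree hypotheses are in the form `m i • 1` of `Away.mk` (from
`G i ∈ 𝒜 (m i)` by `simpa`); any proofs may be used, by proof irrelevance.
[cite: Kawasaki2000, proof of La. 5.3] -/
theorem span_evalAway_mk_map_eq {σ : Type*} (m : σ → ℕ) (G : σ → MvPolynomial (Fin (n + 1)) k)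
    (hG : ∀ i, G i ∈ grading k n (m i • 1)) (j l : Fin (n + 1)) :
    (Ideal.span (Set.range fun i => evalAway ι (X j)
        (Away.mk (grading k n) (Segre.X_mem k j) (m i) (G i) (hG i)))).map
      (Z.presheaf.map (homOfLE (ZH_mono ι ⟨X l, rfl⟩)).op).hom =
    (Ideal.span (Set.range fun i => evalAway ι (X l)
        (Away.mk (grading k n) (Segre.X_mem k l) (m i) (G i) (hG i)))).map
      (Z.presheaf.map (homOfLE (ZH_mono ι ⟨X j, mul_comm (X j) (X l)⟩)).op).hom := by
  rw [Ideal.map_span, Ideal.map_span, ← Set.range_comp, ← Set.range_comp]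
  refine span_range_eq_of_unit_mul _ _
    (fun i => evalAway ι (X j * X l) (awayMap (grading k n) (Segre.X_mem k j)
      (mul_comm (X j) (X l) : (X j * X l : MvPolynomial (Fin (n + 1)) k) = X l * X j)
      (Away.isLocalizationElem (Segre.X_mem k l) (Segre.X_mem k j))) ^ m i)
    (fun i => ((isUnit_awayMap_isLocalizationElem (k := k) j l).map _).pow _) fun i => ?_
  simp only [Function.comp_apply]
  rw [← evalAway_awayMap ι (Segre.X_mem k l) rfl, ← evalAway_awayMap ι (Segre.X_mem k j)
    (mul_comm (X j) (X l)), awayMap_mk_eq_pow_mul_awayMap_mk j l (m i) (G i)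
    (hG i), map_mul, map_pow]

/-- **Two-chart compatibility for the chart ideals of a family of forms** (the case of Kawasaki's
proof of Thm. 5.1: `I_j` generated by the dehomogenised forms `r_1, …, r_{i-1}` already chosen;
any proofs of the degree side conditions of `Away.mk` may be used, by proof irrelevance).
[cite: Kawasaki2000, La. 5.3, proof of Thm. 5.1] -/
theorem chartAnn_map_awayMap_eq_of_forms {σ : Type*} (m : σ → ℕ)
    (G : σ → MvPolynomial (Fin (n + 1)) k) (hG : ∀ i, G i ∈ grading k n (m i • 1))
    (T : Finset ℕ) (hT : ∀ q ∈ T, 1 ≤ q) (j l : Fin (n + 1)) :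
    (chartAnn ι j (Ideal.span (Set.range fun i => evalAway ι (X j)
        (Away.mk (grading k n) (Segre.X_mem k j) (m i) (G i) (hG i)))) T).map
        (awayMap (grading k n) (Segre.X_mem k l)
          (rfl : (X j * X l : MvPolynomial (Fin (n + 1)) k) = X j * X l)) =
      (chartAnn ι l (Ideal.span (Set.range fun i => evalAway ι (X l)
        (Away.mk (grading k n) (Segre.X_mem k l) (m i) (G i) (hG i)))) T).map
        (awayMap (grading k n) (Segre.X_mem k j)
          (mul_comm (X j) (X l) : (X j * X l : MvPolynomial (Fin (n + 1)) k) = X l * X j)) :=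
  chartAnn_map_awayMap_eq_of_forall ι _ (fun j l => span_evalAway_mk_map_eq ι m G hG j l) T hT j l

end TwoCharts

end Literature.AlgebraicGeometry.Resolution

end
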